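import Summits.QuantumFields.BalabanUV.T4Continuum.Support.NE7AccumulatedFrameDictionary
import Summits.QuantumFields.BalabanUV.T4Continuum.Support.NE7BlockFrameSecondOrder
import Summits.QuantumFields.BalabanUV.T4Continuum.Support.NE7AccumulatedFrameSecondOrder
import Summits.QuantumFields.BalabanUV.T4Continuum.Support.NE3FramePotBoundSharp
import HarnessLib

/-!
# Support | NE7 (gen 97, ROAD-G96 §9∕§10(ii)∕§11, (Γ3) in LOCAL PRODUCT FORM): THE SECOND-ORDER DEFECT OF THE ACCUMULATED FRAME IS A SUM OF PRODUCTS OF HONEST LOCAL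
# PATH-AVERAGES OF THE LEVEL FIELDS ALONG THE CORNER CHAIN —
# `‖log v_k(z) − Σ_{m<k} frameLin L W̄^m ψ_m (L^{k−m}z)‖ ≤ 3·(Σ_{m<k} PA_m(z))² + 2·Σ_{m<k} SQ_m(z)`,
# `PA_m(z) = L^{−d}Σ_{x∈B(y_m)} Σ_{b⊂Γ_{y_m,x}}‖ψ_m(b)‖`, `SQ_m(z) = L^{−d}Σ_x (Σ_{b⊂Γ_{y_m,x}}‖ψ_m(b)‖)²`, `y_m = L^{k−m}z` — NO sup factor, NO `N`, NO `k` in the constants;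
# with the Jensen letters `PA_m² ≤ SQ_m ≤ dL·Σ_{B(y_m)}‖ψ_m‖²` and the sup-capped corollary `≤ 16dL²·b·Σ_{m<k} L^m·PA_m(z)`

Cell `pub-balaban`, rung (B)+1 sub-cell t4, lineage `b2b-balaban-t4-ne7-p1` (CRUX PROVER NE7 #1 = OWNER of row NE7), generation 97; memo `t4/b2b-balaban-t4-ne7-p1-g96/ROAD-G96.md`
§10(ii) («with the BILINEAR frame bound with the sup cap on the smaller partner … Jensen per level … CS over corners (N-free: both factors corner-local)») and this generation's memo
`t4/b2b-balaban-t4-ne7-p1-g97/ROAD-G97.md` (why the PRODUCT form is the one the letters can use: pure-sup² terms are inadmissible in every ℓ¹-type letter; sup-capping one factor is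
legal only inside ℓ²-type letters).  Over this lineage's `NE7AccumulatedFrameDictionary.level_dictionary` (p738080: `U̿^m = expCfg(Ad_{W̄^m}ψ_m)`, `‖ψ_m‖ ≤ 2L^m b`, `W̄^m` unitary),
`NE7BlockFrameSecondOrder.norm_Fcov_sub_frameLin_le` (ONE block frame to second order with the path-weighted bound `2L^{−d}Σ_r lnorm_r²`), `NE7AccumulatedFrameSecondOrder.
norm_mlog_vcov_sub_sum_le` (`‖log v_k − Σ_m Fcov_m‖ ≤ 2S²`), row NE3's staircase letter `NE3FramePotBoundSharp.lnorm_treeWord_boxVec_sq_le` (`lnorm² ≤ dL·(block energy)`), and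
`AveragingDeficitTransport.norm_dhol_le`.

WHY (memo ROAD-G97 §2).  Every letter of the binder `hdecomp♭` that the top pure gauge's parameter `η_z = log v_{k+1}(z)` enters is either an ℓ¹ sum over the torus (the κ-letter,
the quartic remainder) or an ℓ² energy (the ν-letter); in both, a bound of the corner quantity `h_z` by `(global sup)²` is useless (it does not vanish with the local energy and
costs the number of corners), and in the ℓ¹-type letters even `sup × honest` fails (ℓ¹ over corners of a first-order reading costs `√#corners`).  What closes is a bound by PRODUCTS
of honest local readings — here the path-averages `PA_m`, `SQ_m` of the NONLINEAR level fields `ψ_m` along the tree contours of the corner chain's blocks — whose squares are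
bounded by local block energies (Jensen, §1) and hence, summed over corners, by the global ℓ² tower letters of row NE3 (`RemainderTowerLevelsB8.sqrt_l2sq_logCovIter_le`).  THIS FILE
proves that product form (§2), k-free and N-free, plus its sup-capped corollary (§3, the shape memo ROAD-G96 §10(ii) wrote: `h_z ≤ 2dα·Σ_j L^j|t_j(z)| + …`).  The comparison with
the LINEAR readings `QbarIter L m W X` (the frames of the Prop-4 remainders) is kept as a separate additive term (§2, `…_sub_framePotW_le_prod`), to be localised by the consumer.
WHAT ([folklore]; 0 def, 0 sorry).  §1 `sq_sum_le_two_mul_sum_mul_partial` (`(Σ_{m<k}f_m)² ≤ 2Σ_{l<k} f_l·Σ_{i≤l} f_i`), `norm_frameLin_le_pathAvg` (`‖frameLin L V ψ y‖ ≤ PA`),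
`pathAvg_sq_le_sqAvg` (Jensen `PA² ≤ SQ`), `sqAvg_le_blockEnergy` (`SQ ≤ dL·Σ_{v∈periodBox L}Σ_κ‖ψ(y+v)κ‖²`).  §2 **`norm_mlog_vcov_sub_sum_frameLin_le_prod`** (the display) and
**`norm_mlog_vcov_sub_framePotW_le_prod`** (`… − framePotW L k W X z‖ ≤ 3(ΣPA)² + 2ΣSQ + Σ_m PA_m(ψ_m − QbarIter L m W X)`), in the Prop-4 regime at level `k` with `44·dL·(L^k b) ≤ 1`.
§3 **`norm_mlog_vcov_sub_sum_frameLin_le_supCapped`** (`≤ 16dL²·b·Σ_{m<k} L^m PA_m`).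
HONEST FRAMING (page 1): bookkeeping on OUR frame over landed kernel theorems; nothing of Bałaban's asserted; the corner sums, the slice∕Hardy letters, (Γ4), (Γ5), `hdecomp♭`, NE7 NOT
proved; spine 0∕9; finite T⁴ rung (B)+1 — NOT infinite volume, NOT mass gap, NOT `BetaPertH`, NOT Clay.  Continuum YM on T⁴ ⇐ BetaPertH ∧ nine spine estimates (0/9 proved); BetaPertH ⇐
(D1) ∧ (D4) ∧ CAP+tail; G-an2-4 gates asym, D1 and NE2/3/4.
-/

set_option autoImplicit false

open scoped BigOperators Matrix Matrix.Norms.L2Operator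
open NormedSpace Finset

namespace Summit.QuantumFields.BalabanUV.T4Continuum.NE7AccumulatedFrameDefectLocal

open Literature.MathematicalPhysics.QuantumFieldTheory.Balaban1983to89
open B7Prop1Explicit B7Prop2Explicit B7Prop3Flat MatrixLog
open B7Eq92Concrete (vcov Fcov dbavgCovIter)
open B7Prop4GeneralLevels (logCovIter linCovIter)
open T4AveragingDeficitWall (Ad IsUnitaryCfg)
open T4AveragingDeficitWallBoundary (periodBox)
open AveragingDeficitTransport (dhol lnorm lnorm_cons norm_dhol_le norm_Ad_of_unitary)
open AveragingDeficitNearIdentity (lnorm_nonneg)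
open AveragingDeficitMultiLevelPrep (cavgIter)
open AveragingDeficitMultiLevelBridge (cavgIter_eq_avgIter)
open BlockAveragePushDirSplit (frameLin)
open NE3TangentCovariantTower (QbarIter framePotW)
open NE3.QbarDictionary (adField)
open NE3.PairLandauB8Avg (relPert)
open NE3FramePotBoundSharp (lnorm_treeWord_boxVec_sq_le)
open NE7BlockFrameSecondOrder (norm_Fcov_sub_frameLin_le)
open NE7AccumulatedFrameSecondOrder (norm_mlog_vcov_sub_sum_le)
open NE7AccumulatedFrameDictionary (sum_pow_le_pow frameLin_sub framePotW_eq_sum_frameLin level_dictionary)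

noncomputable section

variable {d : ℕ} {n : Type*} [Fintype n] [DecidableEq n]

/-! ## §1 Elementary letters: level ordering of a square, the path-average bound of the linear frame, Jensen -/

/-- **LEVEL ORDERING OF A SQUARE**: for non-negative `f`, `(Σ_{m<k} f_m)² ≤ 2·Σ_{l<k} f_l·(Σ_{i≤l} f_i)` (telescoping `x² − y² ≤ 2x(x−y)`); the device that lets the LOWER
levels of a product be sup-capped while the highest stays honest. [folklore] -/
theorem sq_sum_le_two_mul_sum_mul_partial (f : ℕ → ℝ) (hf : ∀ m, 0 ≤ f m) :
    ∀ k : ℕ, (∑ m ∈ range k, f m) ^ 2 ≤ 2 * ∑ l ∈ range k, f l * ∑ i ∈ range (l + 1), f i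
  | 0 => by simp
  | k + 1 => by
      rw [Finset.sum_range_succ, Finset.sum_range_succ (fun l => f l * ∑ i ∈ range (l + 1), f i), Finset.sum_range_succ]
      have ih := sq_sum_le_two_mul_sum_mul_partial f hf k
      have hS : 0 ≤ ∑ m ∈ range k, f m := Finset.sum_nonneg fun m _ => hf m
      have ha := hf k
      nlinarith [mul_nonneg ha hS, sq_nonneg (f k)]

/-- **THE LINEAR FRAME IS DOMINATED BY THE PATH-AVERAGE**: at a unitary `V`, `‖frameLin L V ψ y‖ ≤ L^{−d}·Σ_r lnorm ψ y Γ_r` (`‖δ_ψ V(Γ)‖ ≤ Σ_{b⊂Γ}‖ψ_b‖`). [folklore] -/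
theorem norm_frameLin_le_pathAvg (L : ℕ) {V : Site d → Fin d → (Matrix n n ℂ)ˣ} (hV : IsUnitaryCfg V) (ψ : Site d → Fin d → Matrix n n ℂ) (y : Site d) :
    ‖frameLin L V ψ y‖ ≤ ((L : ℝ) ^ d)⁻¹ * ∑ r : Fin d → Fin L, lnorm ψ y (treeWord (boxVec L r)) := by
  letI : CStarAlgebra (Matrix n n ℂ) := {}
  unfold frameLin
  rw [Finset.mul_sum]
  refine (norm_sum_le _ _).trans (Finset.sum_le_sum fun r _ => ?_)
  rw [norm_smul, norm_inv, norm_pow, Real.norm_natCast]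
  exact mul_le_mul_of_nonneg_left (norm_dhol_le hV ψ y _) (by positivity)

/-- **JENSEN FOR THE PATH-AVERAGE**: `(L^{−d}Σ_r x_r)² ≤ L^{−d}Σ_r x_r²` over the `L^d` tree contours (`1 ≤ L`). [folklore] -/
theorem pathAvg_sq_le_sqAvg {L : ℕ} (hL : 1 ≤ L) (x : (Fin d → Fin L) → ℝ) :
    (((L : ℝ) ^ d)⁻¹ * ∑ r : Fin d → Fin L, x r) ^ 2 ≤ ((L : ℝ) ^ d)⁻¹ * ∑ r : Fin d → Fin L, x r ^ 2 := by
  have hcard : (Finset.univ : Finset (Fin d → Fin L)).card = L ^ d := by simp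
  have hLd : (0 : ℝ) < (L : ℝ) ^ d := pow_pos (by exact_mod_cast (by omega : 0 < L)) d
  have hcs : (∑ r : Fin d → Fin L, x r) ^ 2 ≤ (L : ℝ) ^ d * ∑ r : Fin d → Fin L, x r ^ 2 := by
    have h := sq_sum_le_card_mul_sum_sq (s := (univ : Finset (Fin d → Fin L))) (f := x)
    rw [hcard] at h
    push_cast at h
    exact h
  rw [mul_pow, ← one_div, div_pow, one_pow]
  rw [div_mul_eq_mul_div, one_mul, div_le_iff₀ (pow_pos hLd 2), one_div, inv_mul_eq_div, div_mul_eq_mul_div, le_div_iff₀ hLd]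
  nlinarith [hcs, hLd]

/-- **THE SQUARE PATH-AVERAGE AGAINST THE BLOCK ENERGY** (row NE3's staircase letter, averaged): `L^{−d}Σ_r lnorm(ψ; y, Γ_r)² ≤ dL·Σ_{v∈periodBox L}Σ_κ‖ψ(y+v)κ‖²` (`1 ≤ L`).
[folklore] -/
theorem sqAvg_le_blockEnergy {L : ℕ} (hL : 1 ≤ L) (ψ : Site d → Fin d → Matrix n n ℂ) (y : Site d) :
    ((L : ℝ) ^ d)⁻¹ * ∑ r : Fin d → Fin L, lnorm ψ y (treeWord (boxVec L r)) ^ 2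
      ≤ ((d : ℝ) * L) * ∑ v ∈ periodBox (d := d) L, ∑ κ : Fin d, ‖ψ (y + v) κ‖ ^ 2 := by
  have hcard : (Finset.univ : Finset (Fin d → Fin L)).card = L ^ d := by simp
  have hLd : (0 : ℝ) < (L : ℝ) ^ d := pow_pos (by exact_mod_cast (by omega : 0 < L)) d
  set E : ℝ := ((d : ℝ) * L) * ∑ v ∈ periodBox (d := d) L, ∑ κ : Fin d, ‖ψ (y + v) κ‖ ^ 2 with hE
  have hsum : ∑ r : Fin d → Fin L, lnorm ψ y (treeWord (boxVec L r)) ^ 2 ≤ (L : ℝ) ^ d * E := by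
    calc ∑ r : Fin d → Fin L, lnorm ψ y (treeWord (boxVec L r)) ^ 2 ≤ ∑ _r : Fin d → Fin L, E :=
          Finset.sum_le_sum fun r _ => lnorm_treeWord_boxVec_sq_le hL ψ y r
      _ = (L : ℝ) ^ d * E := by rw [Finset.sum_const, hcard, nsmul_eq_mul]; push_cast; ring
  calc ((L : ℝ) ^ d)⁻¹ * ∑ r : Fin d → Fin L, lnorm ψ y (treeWord (boxVec L r)) ^ 2
      ≤ ((L : ℝ) ^ d)⁻¹ * ((L : ℝ) ^ d * E) := mul_le_mul_of_nonneg_left hsum (by positivity)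
    _ = E := by field_simp

/-- The path-average is dominated by the sup along the contours: `‖ψ‖ ≤ s` ⟹ `L^{−d}Σ_r lnorm(ψ; y, Γ_r) ≤ dL·s` and every `lnorm(ψ; y, Γ_r) ≤ dL·s` (`1 ≤ L`). [folklore] -/
theorem pathAvg_le_of_sup {L : ℕ} (hL : 1 ≤ L) {ψ : Site d → Fin d → Matrix n n ℂ} {s : ℝ} (hs : 0 ≤ s)
    (hψ : ∀ (x : Site d) (κ : Fin d), ‖ψ x κ‖ ≤ s) (y : Site d) :
    (∀ r : Fin d → Fin L, lnorm ψ y (treeWord (boxVec L r)) ≤ (d : ℝ) * L * s) ∧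
      ((L : ℝ) ^ d)⁻¹ * ∑ r : Fin d → Fin L, lnorm ψ y (treeWord (boxVec L r)) ≤ (d : ℝ) * L * s := by
  have hlen : ∀ (w : List (Letter d)) (x : Site d), lnorm ψ x w ≤ w.length * s := by
    intro w
    induction w with
    | nil => intro x; simp
    | cons l w ih =>
        intro x
        rw [lnorm_cons, List.length_cons, Nat.cast_succ]
        have := hψ (if l.2 then x else x + l.vec) l.1
        have := ih (x + l.vec)
        linarith
  have htree : ∀ r : Fin d → Fin L, lnorm ψ y (treeWord (boxVec L r)) ≤ (d : ℝ) * L * s := by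
    intro r
    refine (hlen _ y).trans ?_
    have h := l1_boxVec_le L r
    rw [← length_treeWord] at h
    have : ((treeWord (boxVec L r)).length : ℝ) ≤ (d : ℝ) * L := by exact_mod_cast h
    nlinarith
  refine ⟨htree, ?_⟩
  have hcard : (Finset.univ : Finset (Fin d → Fin L)).card = L ^ d := by simp
  have hLd : (0 : ℝ) < (L : ℝ) ^ d := pow_pos (by exact_mod_cast (by omega : 0 < L)) d
  calc ((L : ℝ) ^ d)⁻¹ * ∑ r : Fin d → Fin L, lnorm ψ y (treeWord (boxVec L r))
      ≤ ((L : ℝ) ^ d)⁻¹ * ∑ _r : Fin d → Fin L, (d : ℝ) * L * s := mul_le_mul_of_nonneg_left (Finset.sum_le_sum fun r _ => htree r) (by positivity)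
    _ = (d : ℝ) * L * s := by rw [Finset.sum_const, hcard, nsmul_eq_mul]; push_cast; field_simp

/-! ## §2 The product form -/

/-- **(Γ3) IN LOCAL PRODUCT FORM**: in the regime of [Balaban1985Averaging] Prop. 4 at level `k` (hypotheses of `NE7AccumulatedFrameDictionary.level_dictionary`; `W` unitary,
`sup‖X‖ ≤ b`, `44·dL·(L^k b) ≤ 1`), with `W̄^m = avgIter L W m`, `ψ_m = Ad_{W̄^m}⁻¹ logCovIter L W (Ad_W X) m`, `y_m = L^{k−m}•z` and the path functionals
`PA_m = L^{−d}Σ_r lnorm(ψ_m; y_m, Γ_r)`, `SQ_m = L^{−d}Σ_r lnorm(ψ_m; y_m, Γ_r)²`: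
`‖log v_k(z) − Σ_{m<k} frameLin L W̄^m ψ_m y_m‖ ≤ 3·(Σ_{m<k} PA_m)² + 2·Σ_{m<k} SQ_m` — no sup factor, no `N`, no `k` in the constants. [folklore] -/
theorem norm_mlog_vcov_sub_sum_frameLin_le_prod [Nonempty n] {L : ℕ} (hL : 2 ≤ L) (k : ℕ)
    {W : Site d → Fin d → (Matrix n n ℂ)ˣ} (hWu : IsUnitaryCfg W) {X : Site d → Fin d → Matrix n n ℂ}
    {α₀ b : ℝ} (hα : 0 < α₀) (hα3 : C0 d * α₀ ≤ 1 / 3) (hα4 : 4 * α₀ ≤ c2' d L)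
    (h52 : pdev W < α₀ * (((L : ℝ) ^ k)⁻¹) ^ 2) (hb : 0 ≤ b) (hX : ∀ (y : Site d) (κ : Fin d), ‖X y κ‖ ≤ b)
    (hsmall : Real.exp (4 * (800 * ((d : ℝ) + 1) ^ 2 * ((d : ℝ) + 4)) * α₀)
      * (1 + 8 * (131072 * ((d : ℝ) + 1) ^ 2) * ((L : ℝ) ^ k * b)) ≤ 2)
    (hc₃ : 2 * ((L : ℝ) ^ k * b) ≤ c3 d L) (h44 : 44 * ((d : ℝ) * L * ((L : ℝ) ^ k * b)) ≤ 1) (z : Site d) :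
    ‖mlog ((vcov L W (relPert W X) k z : (Matrix n n ℂ)ˣ) : Matrix n n ℂ)
        - ∑ m ∈ range k, frameLin L (avgIter L W m)
            (fun x μ => Ad (avgIter L W m x μ)⁻¹ (logCovIter L W (adField W X) m x μ)) (((L : ℤ) ^ (k - m)) • z)‖
      ≤ 3 * (∑ m ∈ range k, ((L : ℝ) ^ d)⁻¹ * ∑ r : Fin d → Fin L,
              lnorm (fun x μ => Ad (avgIter L W m x μ)⁻¹ (logCovIter L W (adField W X) m x μ)) (((L : ℤ) ^ (k - m)) • z) (treeWord (boxVec L r))) ^ 2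
        + 2 * ∑ m ∈ range k, ((L : ℝ) ^ d)⁻¹ * ∑ r : Fin d → Fin L,
              lnorm (fun x μ => Ad (avgIter L W m x μ)⁻¹ (logCovIter L W (adField W X) m x μ)) (((L : ℤ) ^ (k - m)) • z) (treeWord (boxVec L r)) ^ 2 := by
  letI : CStarAlgebra (Matrix n n ℂ) := {}
  have hL1 : 1 ≤ L := by omega
  have hLR : (2 : ℝ) ≤ L := by exact_mod_cast hL
  have hdict := level_dictionary hL k hWu (X := X) hα hα3 hα4 h52 hb hX hsmall hc₃
  -- abbreviations (no `def`): the level fields, the corner chain, the path functionals, the one-block frames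
  set ψ : ℕ → Site d → Fin d → Matrix n n ℂ := fun m x μ => Ad (avgIter L W m x μ)⁻¹ (logCovIter L W (adField W X) m x μ) with hψ
  set y : ℕ → Site d := fun m => ((L : ℤ) ^ (k - m)) • z with hy
  set PA : ℕ → ℝ := fun m => ((L : ℝ) ^ d)⁻¹ * ∑ r : Fin d → Fin L, lnorm (ψ m) (y m) (treeWord (boxVec L r)) with hPA
  set SQ : ℕ → ℝ := fun m => ((L : ℝ) ^ d)⁻¹ * ∑ r : Fin d → Fin L, lnorm (ψ m) (y m) (treeWord (boxVec L r)) ^ 2 with hSQ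
  set F : ℕ → Matrix n n ℂ := fun m => Fcov L (avgIter L W m) (dbavgCovIter L W (relPert W X) m) (y m) with hF
  show ‖mlog ((vcov L W (relPert W X) k z : (Matrix n n ℂ)ˣ) : Matrix n n ℂ) - ∑ m ∈ range k, frameLin L (avgIter L W m) (ψ m) (y m)‖
      ≤ 3 * (∑ m ∈ range k, PA m) ^ 2 + 2 * ∑ m ∈ range k, SQ m
  have hPA0 : ∀ m, 0 ≤ PA m := fun m => by
    simp only [hPA]; exact mul_nonneg (by positivity) (Finset.sum_nonneg fun r _ => lnorm_nonneg _ _ _)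
  have hSQ0 : ∀ m, 0 ≤ SQ m := fun m => by
    simp only [hSQ]; exact mul_nonneg (by positivity) (Finset.sum_nonneg fun r _ => sq_nonneg _)
  -- level sizes
  have hLm : ∀ m < k, 2 * ((L : ℝ) ^ m * b) ≤ (L : ℝ) ^ k * b := by
    intro m hm
    have h1 : 2 * (L : ℝ) ^ m ≤ (L : ℝ) ^ k := by
      calc 2 * (L : ℝ) ^ m ≤ L * (L : ℝ) ^ m := mul_le_mul_of_nonneg_right hLR (by positivity)
        _ = (L : ℝ) ^ (m + 1) := by ring
        _ ≤ (L : ℝ) ^ k := pow_le_pow_right₀ (by linarith) (by omega)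
    nlinarith
  -- per level: contour smallness, brick 1, the sup cap of `SQ`, the size of `F`
  have hlev : ∀ m < k,
      ‖F m - frameLin L (avgIter L W m) (ψ m) (y m)‖ ≤ 2 * SQ m ∧ SQ m ≤ PA m / 20 ∧ ‖F m‖ ≤ 11 / 10 * PA m ∧ PA m ≤ (d : ℝ) * L * (2 * ((L : ℝ) ^ m * b)) := by
    intro m hm
    obtain ⟨hUm, hexpCfg, -, hsup, -⟩ := hdict m hm.le
    have hβ0 : 0 ≤ 2 * ((L : ℝ) ^ m * b) := by positivity
    obtain ⟨htree, hPAsup⟩ := pathAvg_le_of_sup hL1 hβ0 hsup (y m)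
    -- `dL·2L^m b ≤ 1∕40`
    have ht40 : (d : ℝ) * L * (2 * ((L : ℝ) ^ m * b)) ≤ 1 / 40 := by
      have := mul_le_mul_of_nonneg_left (hLm m hm) (by positivity : (0 : ℝ) ≤ (d : ℝ) * L)
      nlinarith
    have hs : ∀ r : Fin d → Fin L, lnorm (ψ m) (y m) (treeWord (boxVec L r)) ≤ 1 / 20 := fun r => (htree r).trans (by linarith)
    -- brick 1 (path-weighted form)
    have h1 : ‖Fcov L (avgIter L W m) (expCfg (fun x' μ' => Ad (avgIter L W m x' μ') (ψ m x' μ'))) (y m) - frameLin L (avgIter L W m) (ψ m) (y m)‖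
        ≤ 2 * ((L : ℝ) ^ d)⁻¹ * ∑ r : Fin d → Fin L, lnorm (ψ m) (y m) (treeWord (boxVec L r)) ^ 2 :=
      norm_Fcov_sub_frameLin_le hUm (ψ m) (y m) hs
    rw [← hexpCfg] at h1
    have h1' : ‖F m - frameLin L (avgIter L W m) (ψ m) (y m)‖ ≤ 2 * SQ m := by
      simp only [hF, hSQ]; rw [← mul_assoc]; exact h1
    -- `SQ ≤ (dL·2L^m b)·PA ≤ PA∕40`
    have hSQle : SQ m ≤ (d : ℝ) * L * (2 * ((L : ℝ) ^ m * b)) * PA m := by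
      have hterm : ∑ r : Fin d → Fin L, lnorm (ψ m) (y m) (treeWord (boxVec L r)) ^ 2
          ≤ ∑ r : Fin d → Fin L, (d : ℝ) * L * (2 * ((L : ℝ) ^ m * b)) * lnorm (ψ m) (y m) (treeWord (boxVec L r)) :=
        Finset.sum_le_sum fun r _ => by
          rw [sq]; exact mul_le_mul_of_nonneg_right (htree r) (lnorm_nonneg _ _ _)
      have hLd0 : (0 : ℝ) ≤ ((L : ℝ) ^ d)⁻¹ := by positivity
      calc SQ m = ((L : ℝ) ^ d)⁻¹ * ∑ r : Fin d → Fin L, lnorm (ψ m) (y m) (treeWord (boxVec L r)) ^ 2 := rfl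
        _ ≤ ((L : ℝ) ^ d)⁻¹ * ∑ r : Fin d → Fin L, (d : ℝ) * L * (2 * ((L : ℝ) ^ m * b)) * lnorm (ψ m) (y m) (treeWord (boxVec L r)) :=
            mul_le_mul_of_nonneg_left hterm hLd0
        _ = (d : ℝ) * L * (2 * ((L : ℝ) ^ m * b)) * PA m := by
            simp only [hPA]; rw [← Finset.mul_sum]; ring
    have hSQ20 : SQ m ≤ PA m / 20 := by
      have := mul_le_mul_of_nonneg_right ht40 (hPA0 m)
      have := hPA0 m
      linarith
    -- `‖F‖ ≤ ‖frameLin ψ‖ + 2SQ ≤ PA + PA∕10`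
    have hfl : ‖frameLin L (avgIter L W m) (ψ m) (y m)‖ ≤ PA m := norm_frameLin_le_pathAvg L hUm (ψ m) (y m)
    have hFle : ‖F m‖ ≤ 11 / 10 * PA m := by
      have htri : ‖F m‖ ≤ ‖F m - frameLin L (avgIter L W m) (ψ m) (y m)‖ + ‖frameLin L (avgIter L W m) (ψ m) (y m)‖ :=
        norm_le_norm_sub_add _ _
      linarith
    exact ⟨h1', hSQ20, hFle, hPAsup⟩
  -- `S = Σ‖F_m‖ ≤ 1.1·ΣPA ≤ 1∕20`
  have hS : ∑ m ∈ range k, ‖F m‖ ≤ 11 / 10 * ∑ m ∈ range k, PA m := by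
    rw [Finset.mul_sum]
    exact Finset.sum_le_sum fun m hm => (hlev m (Finset.mem_range.mp hm)).2.2.1
  have hPAsum : ∑ m ∈ range k, PA m ≤ 2 * ((d : ℝ) * L) * ((L : ℝ) ^ k * b) := by
    calc ∑ m ∈ range k, PA m ≤ ∑ m ∈ range k, (d : ℝ) * L * (2 * ((L : ℝ) ^ m * b)) :=
          Finset.sum_le_sum fun m hm => (hlev m (Finset.mem_range.mp hm)).2.2.2
      _ = 2 * ((d : ℝ) * L) * ((∑ m ∈ range k, (L : ℝ) ^ m) * b) := by rw [Finset.sum_mul, Finset.mul_sum]; refine Finset.sum_congr rfl fun m _ => ?_; ring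
      _ ≤ 2 * ((d : ℝ) * L) * ((L : ℝ) ^ k * b) :=
          mul_le_mul_of_nonneg_left (mul_le_mul_of_nonneg_right (sum_pow_le_pow hLR k) hb) (by positivity)
  have hS20 : ∑ m ∈ range k, ‖Fcov L (avgIter L W m) (dbavgCovIter L W (relPert W X) m) (((L : ℤ) ^ (k - m)) • z)‖ ≤ 1 / 20 := by
    show ∑ m ∈ range k, ‖F m‖ ≤ 1 / 20
    nlinarith [hS, hPAsum, h44]
  -- brick 2
  have h2 := norm_mlog_vcov_sub_sum_le L W (relPert W X) k z hS20
  have hS0 : 0 ≤ ∑ m ∈ range k, ‖F m‖ := Finset.sum_nonneg fun m _ => norm_nonneg _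
  have hsq : (∑ m ∈ range k, ‖Fcov L (avgIter L W m) (dbavgCovIter L W (relPert W X) m) (((L : ℤ) ^ (k - m)) • z)‖) ^ 2
      ≤ (11 / 10 * ∑ m ∈ range k, PA m) ^ 2 := by
    show (∑ m ∈ range k, ‖F m‖) ^ 2 ≤ _
    exact pow_le_pow_left₀ hS0 hS 2
  -- the per-level differences, summed
  have hD : ‖∑ m ∈ range k, F m - ∑ m ∈ range k, frameLin L (avgIter L W m) (ψ m) (y m)‖ ≤ 2 * ∑ m ∈ range k, SQ m := by
    rw [← Finset.sum_sub_distrib, Finset.mul_sum]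
    exact (norm_sum_le _ _).trans (Finset.sum_le_sum fun m hm => (hlev m (Finset.mem_range.mp hm)).1)
  set M₀ : Matrix n n ℂ := mlog ((vcov L W (relPert W X) k z : (Matrix n n ℂ)ˣ) : Matrix n n ℂ) with hM₀
  have hPs0 : 0 ≤ ∑ m ∈ range k, PA m := Finset.sum_nonneg fun m _ => hPA0 m
  calc ‖M₀ - ∑ m ∈ range k, frameLin L (avgIter L W m) (ψ m) (y m)‖
      = ‖(M₀ - ∑ m ∈ range k, F m) + (∑ m ∈ range k, F m - ∑ m ∈ range k, frameLin L (avgIter L W m) (ψ m) (y m))‖ := by rw [sub_add_sub_cancel]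
    _ ≤ 2 * (11 / 10 * ∑ m ∈ range k, PA m) ^ 2 + 2 * ∑ m ∈ range k, SQ m :=
        (norm_add_le _ _).trans (add_le_add (h2.trans (mul_le_mul_of_nonneg_left hsq (by norm_num))) hD)
    _ ≤ 3 * (∑ m ∈ range k, PA m) ^ 2 + 2 * ∑ m ∈ range k, SQ m := by nlinarith [sq_nonneg (∑ m ∈ range k, PA m)]

/-- **THE SAME AGAINST THE TREE's ACCUMULATED LINEAR FRAME**: `‖log v_k(z) − framePotW L k W X z‖ ≤ 3(ΣPA_m)² + 2ΣSQ_m + Σ_{m<k} L^{−d}Σ_r lnorm(ψ_m − QbarIter L m W X; y_m, Γ_r)`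
— the last term is the path-average of the [B7]-Prop-4 remainder of level `m` read by the block frame at the corner chain (`framePotW_eq_sum_frameLin`, `frameLin_sub`,
`norm_frameLin_le_pathAvg`); its localisation is the consumer's. [folklore] -/
theorem norm_mlog_vcov_sub_framePotW_le_prod [Nonempty n] {L : ℕ} (hL : 2 ≤ L) (k : ℕ)
    {W : Site d → Fin d → (Matrix n n ℂ)ˣ} (hWu : IsUnitaryCfg W) {X : Site d → Fin d → Matrix n n ℂ}
    {α₀ b : ℝ} (hα : 0 < α₀) (hα3 : C0 d * α₀ ≤ 1 / 3) (hα4 : 4 * α₀ ≤ c2' d L)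
    (h52 : pdev W < α₀ * (((L : ℝ) ^ k)⁻¹) ^ 2) (hb : 0 ≤ b) (hX : ∀ (y : Site d) (κ : Fin d), ‖X y κ‖ ≤ b)
    (hsmall : Real.exp (4 * (800 * ((d : ℝ) + 1) ^ 2 * ((d : ℝ) + 4)) * α₀)
      * (1 + 8 * (131072 * ((d : ℝ) + 1) ^ 2) * ((L : ℝ) ^ k * b)) ≤ 2)
    (hc₃ : 2 * ((L : ℝ) ^ k * b) ≤ c3 d L) (h44 : 44 * ((d : ℝ) * L * ((L : ℝ) ^ k * b)) ≤ 1) (z : Site d) :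
    ‖mlog ((vcov L W (relPert W X) k z : (Matrix n n ℂ)ˣ) : Matrix n n ℂ) - framePotW L k W X z‖
      ≤ 3 * (∑ m ∈ range k, ((L : ℝ) ^ d)⁻¹ * ∑ r : Fin d → Fin L,
              lnorm (fun x μ => Ad (avgIter L W m x μ)⁻¹ (logCovIter L W (adField W X) m x μ)) (((L : ℤ) ^ (k - m)) • z) (treeWord (boxVec L r))) ^ 2
        + 2 * ∑ m ∈ range k, ((L : ℝ) ^ d)⁻¹ * ∑ r : Fin d → Fin L,
              lnorm (fun x μ => Ad (avgIter L W m x μ)⁻¹ (logCovIter L W (adField W X) m x μ)) (((L : ℤ) ^ (k - m)) • z) (treeWord (boxVec L r)) ^ 2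
        + ∑ m ∈ range k, ((L : ℝ) ^ d)⁻¹ * ∑ r : Fin d → Fin L,
              lnorm (fun x μ => Ad (avgIter L W m x μ)⁻¹ (logCovIter L W (adField W X) m x μ) - QbarIter L m W X x μ)
                (((L : ℤ) ^ (k - m)) • z) (treeWord (boxVec L r)) := by
  letI : CStarAlgebra (Matrix n n ℂ) := {}
  have hmain := norm_mlog_vcov_sub_sum_frameLin_le_prod hL k hWu hα hα3 hα4 h52 hb hX hsmall hc₃ h44 z
  have hdict := level_dictionary hL k hWu (X := X) hα hα3 hα4 h52 hb hX hsmall hc₃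
  set ψ : ℕ → Site d → Fin d → Matrix n n ℂ := fun m x μ => Ad (avgIter L W m x μ)⁻¹ (logCovIter L W (adField W X) m x μ) with hψ
  set y : ℕ → Site d := fun m => ((L : ℤ) ^ (k - m)) • z with hy
  -- the frames of the Prop-4 remainders
  have hrem : ‖∑ m ∈ range k, frameLin L (avgIter L W m) (ψ m) (y m) - framePotW L k W X z‖
      ≤ ∑ m ∈ range k, ((L : ℝ) ^ d)⁻¹ * ∑ r : Fin d → Fin L, lnorm (fun x μ => ψ m x μ - QbarIter L m W X x μ) (y m) (treeWord (boxVec L r)) := by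
    rw [framePotW_eq_sum_frameLin L W X k z]
    have e : ∑ m ∈ range k, frameLin L (cavgIter L m W) (QbarIter L m W X) (((L : ℤ) ^ (k - m)) • z)
        = ∑ m ∈ range k, frameLin L (avgIter L W m) (QbarIter L m W X) (y m) :=
      Finset.sum_congr rfl fun m _ => by rw [cavgIter_eq_avgIter]
    rw [e, ← Finset.sum_sub_distrib]
    refine (norm_sum_le _ _).trans (Finset.sum_le_sum fun m hm => ?_)
    obtain ⟨hUm, -, -, -, -⟩ := hdict m (Finset.mem_range.mp hm).le
    rw [frameLin_sub]
    exact norm_frameLin_le_pathAvg L hUm _ (y m)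
  set M₀ : Matrix n n ℂ := mlog ((vcov L W (relPert W X) k z : (Matrix n n ℂ)ˣ) : Matrix n n ℂ) with hM₀
  calc ‖M₀ - framePotW L k W X z‖
      = ‖(M₀ - ∑ m ∈ range k, frameLin L (avgIter L W m) (ψ m) (y m)) + (∑ m ∈ range k, frameLin L (avgIter L W m) (ψ m) (y m) - framePotW L k W X z)‖ := by
        rw [sub_add_sub_cancel]
    _ ≤ _ := (norm_add_le _ _).trans (add_le_add hmain hrem)

/-! ## §3 The sup-capped corollary -/

/-- **(Γ3) WITH THE SUP CAP ON THE LOWER PARTNER** (memo ROAD-G96 §10(ii)'s shape): in the same regime,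
`‖log v_k(z) − Σ_{m<k} frameLin L W̄^m ψ_m y_m‖ ≤ 16·d·L²·b·Σ_{m<k} L^m·PA_m` (`(ΣPA)² ≤ 2Σ_l PA_l·Σ_{i≤l}PA_i`, `Σ_{i≤l} PA_i ≤ 2dLb·Σ_{i≤l}L^i ≤ 2dL²b·L^l`,
`SQ_m ≤ 2dL·L^m b·PA_m`). [folklore] -/
theorem norm_mlog_vcov_sub_sum_frameLin_le_supCapped [Nonempty n] {L : ℕ} (hL : 2 ≤ L) (k : ℕ)
    {W : Site d → Fin d → (Matrix n n ℂ)ˣ} (hWu : IsUnitaryCfg W) {X : Site d → Fin d → Matrix n n ℂ}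
    {α₀ b : ℝ} (hα : 0 < α₀) (hα3 : C0 d * α₀ ≤ 1 / 3) (hα4 : 4 * α₀ ≤ c2' d L)
    (h52 : pdev W < α₀ * (((L : ℝ) ^ k)⁻¹) ^ 2) (hb : 0 ≤ b) (hX : ∀ (y : Site d) (κ : Fin d), ‖X y κ‖ ≤ b)
    (hsmall : Real.exp (4 * (800 * ((d : ℝ) + 1) ^ 2 * ((d : ℝ) + 4)) * α₀)
      * (1 + 8 * (131072 * ((d : ℝ) + 1) ^ 2) * ((L : ℝ) ^ k * b)) ≤ 2)
    (hc₃ : 2 * ((L : ℝ) ^ k * b) ≤ c3 d L) (h44 : 44 * ((d : ℝ) * L * ((L : ℝ) ^ k * b)) ≤ 1) (z : Site d) :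
    ‖mlog ((vcov L W (relPert W X) k z : (Matrix n n ℂ)ˣ) : Matrix n n ℂ)
        - ∑ m ∈ range k, frameLin L (avgIter L W m)
            (fun x μ => Ad (avgIter L W m x μ)⁻¹ (logCovIter L W (adField W X) m x μ)) (((L : ℤ) ^ (k - m)) • z)‖
      ≤ 16 * ((d : ℝ) * (L : ℝ) ^ 2) * b * ∑ m ∈ range k, (L : ℝ) ^ m * (((L : ℝ) ^ d)⁻¹ * ∑ r : Fin d → Fin L,
              lnorm (fun x μ => Ad (avgIter L W m x μ)⁻¹ (logCovIter L W (adField W X) m x μ)) (((L : ℤ) ^ (k - m)) • z) (treeWord (boxVec L r))) := by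
  letI : CStarAlgebra (Matrix n n ℂ) := {}
  have hL1 : 1 ≤ L := by omega
  have hLR : (2 : ℝ) ≤ L := by exact_mod_cast hL
  have hL1R : (1 : ℝ) ≤ L := by linarith
  have hmain := norm_mlog_vcov_sub_sum_frameLin_le_prod hL k hWu hα hα3 hα4 h52 hb hX hsmall hc₃ h44 z
  have hdict := level_dictionary hL k hWu (X := X) hα hα3 hα4 h52 hb hX hsmall hc₃
  set ψ : ℕ → Site d → Fin d → Matrix n n ℂ := fun m x μ => Ad (avgIter L W m x μ)⁻¹ (logCovIter L W (adField W X) m x μ) with hψ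
  set y : ℕ → Site d := fun m => ((L : ℤ) ^ (k - m)) • z with hy
  set PA : ℕ → ℝ := fun m => ((L : ℝ) ^ d)⁻¹ * ∑ r : Fin d → Fin L, lnorm (ψ m) (y m) (treeWord (boxVec L r)) with hPA
  set SQ : ℕ → ℝ := fun m => ((L : ℝ) ^ d)⁻¹ * ∑ r : Fin d → Fin L, lnorm (ψ m) (y m) (treeWord (boxVec L r)) ^ 2 with hSQ
  change ‖mlog ((vcov L W (relPert W X) k z : (Matrix n n ℂ)ˣ) : Matrix n n ℂ) - ∑ m ∈ range k, frameLin L (avgIter L W m) (ψ m) (y m)‖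
      ≤ 3 * (∑ m ∈ range k, PA m) ^ 2 + 2 * ∑ m ∈ range k, SQ m at hmain
  show ‖mlog ((vcov L W (relPert W X) k z : (Matrix n n ℂ)ˣ) : Matrix n n ℂ) - ∑ m ∈ range k, frameLin L (avgIter L W m) (ψ m) (y m)‖
      ≤ 16 * ((d : ℝ) * (L : ℝ) ^ 2) * b * ∑ m ∈ range k, (L : ℝ) ^ m * PA m
  have hPA0 : ∀ m, 0 ≤ PA m := fun m => by
    simp only [hPA]; exact mul_nonneg (by positivity) (Finset.sum_nonneg fun r _ => lnorm_nonneg _ _ _)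
  -- per level: `PA_m ≤ dL·2L^m b` and `SQ_m ≤ dL·2L^m b·PA_m`
  have hlev : ∀ m < k, PA m ≤ (d : ℝ) * L * (2 * ((L : ℝ) ^ m * b)) ∧ SQ m ≤ (d : ℝ) * L * (2 * ((L : ℝ) ^ m * b)) * PA m := by
    intro m hm
    obtain ⟨-, -, -, hsup, -⟩ := hdict m hm.le
    have hβ0 : 0 ≤ 2 * ((L : ℝ) ^ m * b) := by positivity
    obtain ⟨htree, hPAsup⟩ := pathAvg_le_of_sup hL1 hβ0 hsup (y m)
    refine ⟨hPAsup, ?_⟩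
    have hterm : ∑ r : Fin d → Fin L, lnorm (ψ m) (y m) (treeWord (boxVec L r)) ^ 2
        ≤ ∑ r : Fin d → Fin L, (d : ℝ) * L * (2 * ((L : ℝ) ^ m * b)) * lnorm (ψ m) (y m) (treeWord (boxVec L r)) :=
      Finset.sum_le_sum fun r _ => by
        rw [sq]; exact mul_le_mul_of_nonneg_right (htree r) (lnorm_nonneg _ _ _)
    have hLd0 : (0 : ℝ) ≤ ((L : ℝ) ^ d)⁻¹ := by positivity
    calc SQ m = ((L : ℝ) ^ d)⁻¹ * ∑ r : Fin d → Fin L, lnorm (ψ m) (y m) (treeWord (boxVec L r)) ^ 2 := rfl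
      _ ≤ ((L : ℝ) ^ d)⁻¹ * ∑ r : Fin d → Fin L, (d : ℝ) * L * (2 * ((L : ℝ) ^ m * b)) * lnorm (ψ m) (y m) (treeWord (boxVec L r)) :=
          mul_le_mul_of_nonneg_left hterm hLd0
      _ = (d : ℝ) * L * (2 * ((L : ℝ) ^ m * b)) * PA m := by
          simp only [hPA]; rw [← Finset.mul_sum]; ring
  -- the square, level-ordered: `(ΣPA)² ≤ 2Σ_l PA_l·Σ_{i≤l}PA_i ≤ 2Σ_l PA_l·(2dL²b·L^l)`
  have hsq := sq_sum_le_two_mul_sum_mul_partial PA hPA0 k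
  have hpartial : ∀ l < k, ∑ i ∈ range (l + 1), PA i ≤ 2 * ((d : ℝ) * (L : ℝ) ^ 2) * b * (L : ℝ) ^ l := by
    intro l hl
    calc ∑ i ∈ range (l + 1), PA i ≤ ∑ i ∈ range (l + 1), (d : ℝ) * L * (2 * ((L : ℝ) ^ i * b)) :=
          Finset.sum_le_sum fun i hi => (hlev i (by have := Finset.mem_range.mp hi; omega)).1
      _ = 2 * ((d : ℝ) * L) * b * ∑ i ∈ range (l + 1), (L : ℝ) ^ i := by rw [Finset.mul_sum]; refine Finset.sum_congr rfl fun i _ => ?_; ring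
      _ ≤ 2 * ((d : ℝ) * L) * b * (L : ℝ) ^ (l + 1) := mul_le_mul_of_nonneg_left (sum_pow_le_pow hLR (l + 1)) (by positivity)
      _ = 2 * ((d : ℝ) * (L : ℝ) ^ 2) * b * (L : ℝ) ^ l := by ring
  have hsq2 : (∑ m ∈ range k, PA m) ^ 2 ≤ 4 * ((d : ℝ) * (L : ℝ) ^ 2) * b * ∑ l ∈ range k, (L : ℝ) ^ l * PA l := by
    refine hsq.trans ?_
    rw [Finset.mul_sum, Finset.mul_sum]
    refine Finset.sum_le_sum fun l hl => ?_
    have h := mul_le_mul_of_nonneg_left (hpartial l (Finset.mem_range.mp hl)) (hPA0 l)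
    nlinarith
  -- the squares, sup-capped: `2ΣSQ ≤ 4dLb·ΣL^m PA_m ≤ 4dL²b·ΣL^m PA_m`
  have hSQs : 2 * ∑ m ∈ range k, SQ m ≤ 4 * ((d : ℝ) * (L : ℝ) ^ 2) * b * ∑ m ∈ range k, (L : ℝ) ^ m * PA m := by
    rw [Finset.mul_sum, Finset.mul_sum]
    refine Finset.sum_le_sum fun m hm => ?_
    have h := (hlev m (Finset.mem_range.mp hm)).2
    have hx : 0 ≤ (L : ℝ) ^ m * PA m := mul_nonneg (by positivity) (hPA0 m)
    have hLsq : (L : ℝ) ≤ (L : ℝ) ^ 2 := by nlinarith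
    have hLL : (d : ℝ) * L ≤ (d : ℝ) * (L : ℝ) ^ 2 := mul_le_mul_of_nonneg_left hLsq (Nat.cast_nonneg d)
    nlinarith [mul_le_mul_of_nonneg_right hLL (mul_nonneg hb hx)]
  nlinarith [hmain, hsq2, hSQs]

end

end Summit.QuantumFields.BalabanUV.T4Continuum.NE7AccumulatedFrameDefectLocal
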